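import Literature.AlgebraicGeometry.Resolution.SmoothPointOrderCriterion
import Literature.AlgebraicGeometry.Resolution.TaylorUnitOrderCriterion
import Mathlib.RingTheory.Localization.Ideal
import Mathlib.RingTheory.Localization.AtPrime.Basic
import Mathlib.RingTheory.Ideal.IsPrimary
import HarnessLib

/-!
# Chart-uniform order equations: ONE Hasse–Schmidt homomorphism cuts out the order strata at EVERY closed point

Topic: `Literature/AlgebraicGeometry/Resolution`. Let `K` be a PERFECT field and `A` a `K`-algebra of finite type
which is formally unramified over a polynomial ring `K[X_σ]` (`σ` finite; `x_i ∈ A` the images of the variables) —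
the coordinate ring of an affine open of a smooth `K`-scheme with an étale chart. Fix ONE ring homomorphism
`T_A : A → A⟦t_σ⟧` with `constantCoeff ∘ T_A = id`, fixing `K` and with `T_A(x_i) = x_i + t_i` (a «Hasse–Schmidt
homomorphism extending the Taylor shift»; it exists as soon as `A` is moreover formally smooth over `K[X_σ]`,
`HasseSchmidtEtaleLift.exists_hasseSchmidt_of_formallySmooth`). Its components `D^{[β]} = hsComponent T_A β`
(`β ∈ ℕ^σ`) are GLOBAL `K`-linear differential operators of `A` of order `≤ |β|` (`isDiffOpLE_hsComponentₗ`). PROVED: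

* `exists_adaptedGenerators_of_hasseSchmidt` — at EVERY maximal ideal `𝔭` of `A`, the localisation `T` of `T_A` to
  `O = A_𝔭` admits generators `u_i` of `𝔪_O` adapted to first order, `D^{[e_j]} u_i ≡ δ_ij (mod 𝔪_O)` (the datum that
  `SmoothPointFrobeniusCongruence.exists_hasseSchmidt_adapted_of_etaleCoordinates` builds for SOME `T`; here for the
  localisation of the GIVEN global `T_A`, which is the point: one `T_A` serves all closed points at once);
* `algebraMap_mem_maximalIdeal_pow_iff_of_hasseSchmidt` — **the order equations**: for every maximal `𝔭`, `h ∈ A`,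
  `N ∈ ℕ`: `h ∈ 𝔪_{A_𝔭}^N ⟺ D^{[β]} h ∈ 𝔭 for all |β| < N`;
* `mem_pow_iff_of_hasseSchmidt` — the same with `h ∈ 𝔭^N` on the left (powers of maximal ideals are primary);
  `mem_pow_iff_span_hsComponent_le` — `h ∈ 𝔭^N ⟺ (D^{[β]} h : |β| < N) ⊆ 𝔭`: on the maximal spectrum the stratum
  `{ord_𝔭 h ≥ N}` is the ZERO SET of the finitely many global functions `D^{[β]} h`, `|β| < N`;
* `mem_pow_and_not_mem_pow_succ_iff_of_hasseSchmidt` — exact order: `ord_𝔭 h = N ⟺ (∀ |β| < N, D^{[β]}h ∈ 𝔭) ∧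
  (∃ |β| = N, D^{[β]}h ∉ 𝔭)` — inside the closed stratum `{ord ≥ N}` the locus `{ord = N}` is the complement of the
  zero set of the `D^{[β]}h`, `|β| = N`, hence OPEN;
* `exists_hasseSchmidt_orderEquations` — packaged existence for `A` formally étale over `K[X_σ]`.

Why (bearing, nothing of it asserted): the campaign `res-hironaka` (GAP-LEDGER R20, Th. 6.14 (1) of H. Hironaka's
2017 manuscript; lead route README §2 steps (i)/(iii) «ord_η g_i = q_i is OPEN» and the regularity of the top Taylor
coefficients `D^{(β)}g(η)`, `|β| = q_i`, in `η`) needs the order stratum along ALL closed points of a chart to be cut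
out by the SAME regular functions — the pointwise criterion of `SmoothPointOrderCriterion.lean` chooses its
Hasse–Schmidt homomorphism inside the proof, per point. Proof of the equations: localise `T_A` (tree
`exists_hasseSchmidt_localization`), note `D^{[β]}_O ∘ (A → O) = (A → O) ∘ D^{[β]}_A`, build the adapted generators
`u_i = π_i(x_i)/π_i′(x_i)` from the separable minimal polynomials `π_i` of the coordinates of the point exactly as in
`SmoothPointOrderCriterion.lean`, and apply the abstract criterion `HasseSchmidtLocalCriterion`
(`hsComponent_mem_maximalIdeal_of_mem_pow` / `mem_maximalIdeal_pow_succ_of_hsComponent_mem`).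

Sources: [EGAIV4] §16.8, Thm. 16.11.2, §17.6; [Matsumura1987] §27 (higher derivations, extension to localisations);
[VillamayorU2008ReesDiff] §4.1, Remark 4.3 (the order via differential operators on smooth schemes).
-/

noncomputable section

namespace Literature.AlgebraicGeometry.Resolution

open Finsupp IsLocalRing MvPowerSeries

universe u v w

/-! ## Powers of a maximal ideal are detected in the localisation -/

section Primary

variable {A : Type w} [CommRing A]

/-- For a MAXIMAL ideal `𝔭` and `O = A_𝔭`: `h ∈ 𝔭^N ⟺ h ∈ 𝔪_O^N` (`𝔭^N` is `𝔭`-primary, so it is the contraction of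
its extension; Mathlib `IsLocalization.under_map_of_isPrimary_disjoint`). [cite: Matsumura1987, §4 (Thm. 4.1,
extension and contraction of primary ideals under localisation)] -/
theorem mem_pow_iff_algebraMap_mem_maximalIdeal_pow (𝔭 : Ideal A) [𝔭.IsMaximal] (O : Type*) [CommRing O]
    [IsLocalRing O] [Algebra A O] [IsLocalization.AtPrime O 𝔭] (N : ℕ) (h : A) :
    h ∈ 𝔭 ^ N ↔ algebraMap A O h ∈ maximalIdeal O ^ N := by
  rw [← IsLocalization.AtPrime.map_eq_maximalIdeal 𝔭 O, ← Ideal.map_pow, ← Ideal.mem_comap]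
  rcases Nat.eq_zero_or_pos N with rfl | hN
  · simp [Ideal.map_top]
  · have hrad : (𝔭 ^ N).radical = 𝔭 := by
      rw [Ideal.radical_pow 𝔭 hN.ne', Ideal.IsPrime.radical (Ideal.IsMaximal.isPrime inferInstance)]
    have hprim : (𝔭 ^ N).IsPrimary := Ideal.isPrimary_of_isMaximal_radical (by rw [hrad]; infer_instance)
    have hdisj : Disjoint (𝔭.primeCompl : Set A) ↑(𝔭 ^ N) :=
      Set.disjoint_left.mpr fun x hx hx' => hx (Ideal.pow_le_self hN.ne' hx')
    have key := IsLocalization.under_map_of_isPrimary_disjoint 𝔭.primeCompl O hprim hdisj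
    rw [Ideal.under] at key
    rw [key]

end Primary

/-! ## Adapted generators at every maximal ideal, for ONE global Hasse–Schmidt homomorphism -/

section ChartOrder

variable (K : Type u) [Field K] {σ : Type v} [Fintype σ] [DecidableEq σ]
  {A : Type w} [CommRing A] [Algebra K A] [Algebra (MvPolynomial σ K) A] [IsScalarTower K (MvPolynomial σ K) A]

omit [Fintype σ] in
/-- The linear coefficient of `C a + t_i` is `δ_ij`. [folklore] -/
private theorem coeff_single_C_add_X_chart (a : A) (i j : σ) :
    coeff (Finsupp.single j 1) (MvPowerSeries.C a + MvPowerSeries.X i : MvPowerSeries σ A) =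
      if i = j then 1 else 0 := by
  rw [map_add, MvPowerSeries.coeff_C, MvPowerSeries.coeff_X, if_neg (Finsupp.single_ne_zero.mpr one_ne_zero)]
  simp only [zero_add, Finsupp.single_left_inj one_ne_zero, eq_comm]

omit [Fintype σ] [DecidableEq σ] in
/-- A Hasse–Schmidt homomorphism extending the Taylor shift `X_i ↦ x_i + t_i` of `K[X_σ]` (the shape produced by
`exists_hasseSchmidt_of_formallySmooth`) fixes `K`. [cite: Matsumura1987, §27 (higher derivations over a subring:
`D_i(k) = 0` for `k` in the base)] [cite: EGAIV4, §16.11 (Taylor development along a formally étale coordinate system)] -/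
theorem hasseSchmidt_algebraMap_of_taylorShift (TA : A →+* MvPowerSeries σ A)
    (hTAR : ∀ r : MvPolynomial σ K, TA (algebraMap (MvPolynomial σ K) A r) =
      MvPolynomial.eval₂ (MvPowerSeries.C.comp (algebraMap K A))
        (fun i => MvPowerSeries.C (algebraMap (MvPolynomial σ K) A (MvPolynomial.X i)) + MvPowerSeries.X i) r)
    (c : K) : TA (algebraMap K A c) = MvPowerSeries.C (algebraMap K A c) := by
  have hc : algebraMap K A c = algebraMap (MvPolynomial σ K) A (MvPolynomial.C c) := by
    rw [← MvPolynomial.algebraMap_eq, ← IsScalarTower.algebraMap_apply]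
  conv_lhs => rw [hc, hTAR, MvPolynomial.eval₂_C]
  rfl

omit [Fintype σ] [DecidableEq σ] [IsScalarTower K (MvPolynomial σ K) A] in
/-- A Hasse–Schmidt homomorphism extending the Taylor shift sends `x_i` to `x_i + t_i`. [cite: EGAIV4, §16.11
((16.11.2.1): the Taylor development `x_i ↦ x_i + t_i` along a formally étale coordinate system)] -/
theorem hasseSchmidt_X_of_taylorShift (TA : A →+* MvPowerSeries σ A)
    (hTAR : ∀ r : MvPolynomial σ K, TA (algebraMap (MvPolynomial σ K) A r) =
      MvPolynomial.eval₂ (MvPowerSeries.C.comp (algebraMap K A))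
        (fun i => MvPowerSeries.C (algebraMap (MvPolynomial σ K) A (MvPolynomial.X i)) + MvPowerSeries.X i) r)
    (i : σ) : TA (algebraMap (MvPolynomial σ K) A (MvPolynomial.X i)) =
      MvPowerSeries.C (algebraMap (MvPolynomial σ K) A (MvPolynomial.X i)) + MvPowerSeries.X i := by
  rw [hTAR, MvPolynomial.eval₂_X]

omit [Fintype σ] [DecidableEq σ] [Algebra (MvPolynomial σ K) A] [IsScalarTower K (MvPolynomial σ K) A] in
/-- Components commute with localisation: `D^{[β]}_O (a/1) = (D^{[β]}_A a)/1` when `T_O ∘ (A → O) = (A⟦t⟧ → O⟦t⟧) ∘ T_A`.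
[cite: Matsumura1987, §27 (higher derivations extend uniquely to localisations, compatibly with `A → M⁻¹A`)] -/
theorem hsComponent_algebraMap_of_compatible (TA : A →+* MvPowerSeries σ A) (O : Type*) [CommRing O]
    [Algebra A O] (T : O →+* MvPowerSeries σ O)
    (hT : ∀ a, T (algebraMap A O a) = MvPowerSeries.map (algebraMap A O) (TA a)) (β : σ →₀ ℕ) (a : A) :
    hsComponent T β (algebraMap A O a) = algebraMap A O (hsComponent TA β a) := by
  simp only [hsComponent, hT, MvPowerSeries.coeff_map]

omit [Fintype σ] in
/-- **Adapted generators of `𝔪_{A_𝔭}` for the localisation of a GIVEN global Hasse–Schmidt homomorphism.** `K`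
perfect; `A` of finite type over `K`, formally unramified over `K[X_σ]`; `T_A : A → A⟦t_σ⟧` with
`constantCoeff ∘ T_A = id`, fixing `K`, `T_A(x_i) = x_i + t_i`; `𝔭 ⊂ A` maximal, `O = A_𝔭`, and `T : O → O⟦t_σ⟧` with
`constantCoeff ∘ T = id` compatible with `T_A`. Then there are generators `u_i` (`i ∈ σ`) of `𝔪_O` with
`D^{[e_j]} u_i − δ_ij ∈ 𝔪_O`: `u_i = π_i(x_i) · π_i′(x_i)⁻¹` for the (separable: `K` perfect, `A/𝔭` finite over `K`)
minimal polynomials `π_i` of the residues of the `x_i` (`maximalIdeal_eq_span_aeval_of_formallyUnramified` and the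
chain rule `hsComponent_single_aeval`). [cite: EGAIV4, Thm. 16.11.2 and §17.6 (étale coordinates)]
[cite: VillamayorU2008ReesDiff, §4.1 and Remark 4.3] -/
theorem exists_adaptedGenerators_of_hasseSchmidt [PerfectField K]
    [Algebra.FormallyUnramified (MvPolynomial σ K) A] [Algebra.FiniteType K A]
    (TA : A →+* MvPowerSeries σ A) (hTA0 : ∀ a, constantCoeff (TA a) = a)
    (hTAK : ∀ c : K, TA (algebraMap K A c) = MvPowerSeries.C (algebraMap K A c))
    (hTAx : ∀ i, TA (algebraMap (MvPolynomial σ K) A (MvPolynomial.X i)) =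
      MvPowerSeries.C (algebraMap (MvPolynomial σ K) A (MvPolynomial.X i)) + MvPowerSeries.X i)
    (𝔭 : Ideal A) [𝔭.IsMaximal] (O : Type*) [CommRing O] [IsLocalRing O] [Algebra A O]
    [IsLocalization.AtPrime O 𝔭] (T : O →+* MvPowerSeries σ O) (hT0 : ∀ b, constantCoeff (T b) = b)
    (hT : ∀ a, T (algebraMap A O a) = MvPowerSeries.map (algebraMap A O) (TA a)) :
    ∃ u : σ → O, Ideal.span (Set.range u) = maximalIdeal O ∧
      ∀ i j, hsComponent T (Finsupp.single j 1) (u i) - (if i = j then 1 else 0) ∈ maximalIdeal O := by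
  -- the coordinates `x_i ∈ A`
  set x : σ → A := fun i => algebraMap (MvPolynomial σ K) A (MvPolynomial.X i) with hx
  have hTcomp : ∀ (β : σ →₀ ℕ) (a : A),
      hsComponent T β (algebraMap A O a) = algebraMap A O (hsComponent TA β a) :=
    hsComponent_algebraMap_of_compatible TA O T hT
  -- the residue field and the separable minimal polynomials of the coordinates of the point
  letI := Ideal.Quotient.field 𝔭
  haveI : Algebra.FiniteType K (A ⧸ 𝔭) :=
    Algebra.FiniteType.of_surjective (Ideal.Quotient.mkₐ K 𝔭) (Ideal.Quotient.mkₐ_surjective K 𝔭)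
  haveI : Module.Finite K (A ⧸ 𝔭) := finite_of_finite_type_of_isJacobsonRing K (A ⧸ 𝔭)
  set a : σ → A ⧸ 𝔭 := fun i => Ideal.Quotient.mk 𝔭 (x i) with ha
  have hint : ∀ i, IsIntegral K (a i) := fun i => Algebra.IsIntegral.isIntegral (a i)
  set π : σ → Polynomial K := fun i => minpoly K (a i) with hπ
  have hπsep : ∀ i, (π i).Separable := fun i =>
    PerfectField.separable_of_irreducible (minpoly.irreducible (hint i))
  have hπ𝔭 : ∀ i, Polynomial.aeval (x i) (π i) ∈ 𝔭 := by
    intro i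
    rw [← Ideal.Quotient.eq_zero_iff_mem, ← Ideal.Quotient.algebraMap_eq, ← Polynomial.aeval_algebraMap_apply,
      Ideal.Quotient.algebraMap_eq]
    exact minpoly.aeval K (a i)
  have hπ'𝔭 : ∀ i, Polynomial.aeval (x i) (Polynomial.derivative (π i)) ∉ 𝔭 := by
    intro i hmem
    apply (hπsep i).aeval_derivative_ne_zero (minpoly.aeval K (a i))
    rw [ha]
    simp only
    rw [← Ideal.Quotient.algebraMap_eq, Polynomial.aeval_algebraMap_apply, Ideal.Quotient.algebraMap_eq,
      Ideal.Quotient.eq_zero_iff_mem]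
    exact hmem
  -- the maximal ideal of `O` is generated by the `w_i = π_i(x_i)`
  have hmax := maximalIdeal_eq_span_aeval_of_formallyUnramified K 𝔭 O π hπsep hπ𝔭
  set w : σ → O := fun i => algebraMap A O (Polynomial.aeval (x i) (π i)) with hw
  have hmax' : maximalIdeal O = Ideal.span (Set.range w) := hmax
  have hw𝔪 : ∀ i, w i ∈ maximalIdeal O := fun i => hmax' ▸ Ideal.subset_span ⟨i, rfl⟩
  -- the units `v_i = π_i′(x_i)` and the adapted generators `u_i = w_i v_i⁻¹`
  have hv : ∀ i, IsUnit (algebraMap A O (Polynomial.aeval (x i) (Polynomial.derivative (π i)))) := fun i =>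
    IsLocalization.map_units O (⟨_, hπ'𝔭 i⟩ : 𝔭.primeCompl)
  set u : σ → O := fun i => w i * ↑(hv i).unit⁻¹ with hu
  have hspan : Ideal.span (Set.range u) = maximalIdeal O := by
    rw [hmax']
    apply le_antisymm
    · rw [Ideal.span_le]
      rintro _ ⟨i, rfl⟩
      exact Ideal.mul_mem_right _ _ (Ideal.subset_span ⟨i, rfl⟩)
    · rw [Ideal.span_le]
      rintro _ ⟨i, rfl⟩
      have : w i = u i * ↑(hv i).unit := by
        rw [hu]
        simp only
        rw [mul_assoc, Units.inv_mul, mul_one]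
      rw [SetLike.mem_coe, this]
      exact Ideal.mul_mem_right _ _ (Ideal.subset_span ⟨i, rfl⟩)
  -- first-order adaptation `D^{[e_j]} u_i ≡ δ_ij (mod 𝔪)`
  have hDw : ∀ i j, hsComponent T (Finsupp.single j 1) (w i) =
      algebraMap A O (Polynomial.aeval (x i) (Polynomial.derivative (π i))) * (if i = j then 1 else 0) := by
    intro i j
    rw [hw]
    simp only
    rw [hTcomp, hsComponent_single_aeval TA hTA0 hTAK, map_mul]
    congr 1
    rw [hsComponent, hTAx, coeff_single_C_add_X_chart]
    split_ifs <;> simp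
  have hlin : ∀ i j, hsComponent T (Finsupp.single j 1) (u i) - (if i = j then 1 else 0) ∈ maximalIdeal O := by
    intro i j
    rw [hu]
    simp only
    rw [hsComponent_single_mul T hT0, hDw]
    have hrest : w i * hsComponent T (Finsupp.single j 1) ↑(hv i).unit⁻¹ ∈ maximalIdeal O :=
      Ideal.mul_mem_right _ _ (hw𝔪 i)
    have hvv : algebraMap A O (Polynomial.aeval (x i) (Polynomial.derivative (π i))) * ↑(hv i).unit⁻¹ = 1 :=
      (hv i).mul_val_inv
    split_ifs with hij
    · rw [mul_one, hvv, add_sub_cancel_left]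
      exact hrest
    · rw [mul_zero, zero_mul, zero_add, sub_zero]
      exact hrest
  exact ⟨u, hspan, hlin⟩

/-! ## The order equations -/

/-- **Chart-uniform order equations (stalk form).** `K` perfect; `A` of finite type over `K`, formally unramified
over `K[X_σ]`; `T_A : A → A⟦t_σ⟧` a Hasse–Schmidt homomorphism fixing `K` with `T_A(x_i) = x_i + t_i`. Then for EVERY
maximal ideal `𝔭 ⊂ A` (`O = A_𝔭`), every `h ∈ A` and every `N`:
`h/1 ∈ 𝔪_O^N ⟺ D^{[β]} h ∈ 𝔭` for all `β` with `|β| < N` — the `𝔪_𝔭`-adic order of `h` at each closed point is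
read off the GLOBAL functions `D^{[β]} h = hsComponent T_A β h`. [cite: EGAIV4, Thm. 16.11.2 and §17.6]
[cite: VillamayorU2008ReesDiff, §4.1 and Remark 4.3] [cite: Matsumura1987, §27 (higher derivations)] -/
theorem algebraMap_mem_maximalIdeal_pow_iff_of_hasseSchmidt [PerfectField K]
    [Algebra.FormallyUnramified (MvPolynomial σ K) A] [Algebra.FiniteType K A]
    (TA : A →+* MvPowerSeries σ A) (hTA0 : ∀ a, constantCoeff (TA a) = a)
    (hTAK : ∀ c : K, TA (algebraMap K A c) = MvPowerSeries.C (algebraMap K A c))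
    (hTAx : ∀ i, TA (algebraMap (MvPolynomial σ K) A (MvPolynomial.X i)) =
      MvPowerSeries.C (algebraMap (MvPolynomial σ K) A (MvPolynomial.X i)) + MvPowerSeries.X i)
    (𝔭 : Ideal A) [𝔭.IsMaximal] (O : Type*) [CommRing O] [IsLocalRing O] [Algebra A O]
    [IsLocalization.AtPrime O 𝔭] (N : ℕ) (h : A) :
    algebraMap A O h ∈ maximalIdeal O ^ N ↔
      ∀ β : σ →₀ ℕ, degree β < N → hsComponent TA β h ∈ 𝔭 := by
  -- localise `T_A` to `O` (any `K`-structure on `O` through `A` will do for the localisation lemma)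
  letI : Algebra K O := ((algebraMap A O).comp (algebraMap K A)).toAlgebra
  haveI : IsScalarTower K A O := IsScalarTower.of_algebraMap_eq fun _ => rfl
  obtain ⟨T, hT0, -, hT⟩ := exists_hasseSchmidt_localization TA O 𝔭.primeCompl hTA0 hTAK
  have hTcomp : ∀ (β : σ →₀ ℕ) (a : A),
      hsComponent T β (algebraMap A O a) = algebraMap A O (hsComponent TA β a) :=
    hsComponent_algebraMap_of_compatible TA O T hT
  obtain ⟨u, hu, hlin⟩ := exists_adaptedGenerators_of_hasseSchmidt K TA hTA0 hTAK hTAx 𝔭 O T hT0 hT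
  constructor
  · intro hN β hβ
    obtain ⟨M, rfl⟩ : ∃ M, N = M + 1 := ⟨N - 1, by omega⟩
    have h1 := hsComponent_mem_maximalIdeal_of_mem_pow T hT0 hN (β := β) (by omega)
    rw [hTcomp] at h1
    exact (IsLocalization.AtPrime.to_map_mem_maximal_iff O 𝔭 _).mp h1
  · intro hβ
    cases N with
    | zero => simp
    | succ M =>
      refine mem_maximalIdeal_pow_succ_of_hsComponent_mem T hT0 hu hlin M _ fun β hβ' => ?_
      rw [hTcomp]
      exact (IsLocalization.AtPrime.to_map_mem_maximal_iff O 𝔭 _).mpr (hβ β (by omega))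

/-- **Chart-uniform order equations (ideal form).** In the setting of
`algebraMap_mem_maximalIdeal_pow_iff_of_hasseSchmidt`, for every maximal `𝔭`, every `h ∈ A` and every `N`:
`h ∈ 𝔭^N ⟺ D^{[β]} h ∈ 𝔭 for all |β| < N`. [cite: EGAIV4, Thm. 16.11.2 and §17.6]
[cite: VillamayorU2008ReesDiff, §4.1 and Remark 4.3] -/
theorem mem_pow_iff_of_hasseSchmidt [PerfectField K]
    [Algebra.FormallyUnramified (MvPolynomial σ K) A] [Algebra.FiniteType K A]
    (TA : A →+* MvPowerSeries σ A) (hTA0 : ∀ a, constantCoeff (TA a) = a)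
    (hTAK : ∀ c : K, TA (algebraMap K A c) = MvPowerSeries.C (algebraMap K A c))
    (hTAx : ∀ i, TA (algebraMap (MvPolynomial σ K) A (MvPolynomial.X i)) =
      MvPowerSeries.C (algebraMap (MvPolynomial σ K) A (MvPolynomial.X i)) + MvPowerSeries.X i)
    (𝔭 : Ideal A) [𝔭.IsMaximal] (N : ℕ) (h : A) :
    h ∈ 𝔭 ^ N ↔ ∀ β : σ →₀ ℕ, degree β < N → hsComponent TA β h ∈ 𝔭 := by
  rw [mem_pow_iff_algebraMap_mem_maximalIdeal_pow 𝔭 (Localization.AtPrime 𝔭) N h]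
  exact algebraMap_mem_maximalIdeal_pow_iff_of_hasseSchmidt K TA hTA0 hTAK hTAx 𝔭 (Localization.AtPrime 𝔭) N h

/-- **The order stratum is a zero set of global functions**: `h ∈ 𝔭^N ⟺ (D^{[β]} h : |β| < N)·A ⊆ 𝔭` — on the maximal
spectrum of `A`, `{𝔭 : ord_𝔭 h ≥ N} = V(D^{[β]} h, |β| < N)`. [cite: EGAIV4, Thm. 16.11.2 and §17.6]
[cite: VillamayorU2008ReesDiff, §4.1 and Remark 4.3] -/
theorem mem_pow_iff_span_hsComponent_le [PerfectField K]
    [Algebra.FormallyUnramified (MvPolynomial σ K) A] [Algebra.FiniteType K A]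
    (TA : A →+* MvPowerSeries σ A) (hTA0 : ∀ a, constantCoeff (TA a) = a)
    (hTAK : ∀ c : K, TA (algebraMap K A c) = MvPowerSeries.C (algebraMap K A c))
    (hTAx : ∀ i, TA (algebraMap (MvPolynomial σ K) A (MvPolynomial.X i)) =
      MvPowerSeries.C (algebraMap (MvPolynomial σ K) A (MvPolynomial.X i)) + MvPowerSeries.X i)
    (𝔭 : Ideal A) [𝔭.IsMaximal] (N : ℕ) (h : A) :
    h ∈ 𝔭 ^ N ↔ Ideal.span ((fun β : σ →₀ ℕ => hsComponent TA β h) '' {β | degree β < N}) ≤ 𝔭 := by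
  rw [mem_pow_iff_of_hasseSchmidt K TA hTA0 hTAK hTAx 𝔭 N h, Ideal.span_le]
  constructor
  · rintro hβ _ ⟨β, hβN, rfl⟩
    exact hβ β hβN
  · intro hsub β hβN
    exact hsub ⟨β, hβN, rfl⟩

/-- **Exact order**: `h ∈ 𝔭^N ∖ 𝔭^{N+1} ⟺ (∀ |β| < N, D^{[β]} h ∈ 𝔭) ∧ (∃ |β| = N, D^{[β]} h ∉ 𝔭)`. Inside the closed
stratum `{ord_𝔭 h ≥ N}` the locus `{ord_𝔭 h = N}` is the complement of `V(D^{[β]} h, |β| = N)`, hence OPEN in it.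
[cite: EGAIV4, Thm. 16.11.2 and §17.6] [cite: VillamayorU2008ReesDiff, §4.1 and Remark 4.3] -/
theorem mem_pow_and_not_mem_pow_succ_iff_of_hasseSchmidt [PerfectField K]
    [Algebra.FormallyUnramified (MvPolynomial σ K) A] [Algebra.FiniteType K A]
    (TA : A →+* MvPowerSeries σ A) (hTA0 : ∀ a, constantCoeff (TA a) = a)
    (hTAK : ∀ c : K, TA (algebraMap K A c) = MvPowerSeries.C (algebraMap K A c))
    (hTAx : ∀ i, TA (algebraMap (MvPolynomial σ K) A (MvPolynomial.X i)) =
      MvPowerSeries.C (algebraMap (MvPolynomial σ K) A (MvPolynomial.X i)) + MvPowerSeries.X i)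
    (𝔭 : Ideal A) [𝔭.IsMaximal] (N : ℕ) (h : A) :
    (h ∈ 𝔭 ^ N ∧ h ∉ 𝔭 ^ (N + 1)) ↔
      (∀ β : σ →₀ ℕ, degree β < N → hsComponent TA β h ∈ 𝔭) ∧
        ∃ β : σ →₀ ℕ, degree β = N ∧ hsComponent TA β h ∉ 𝔭 := by
  rw [mem_pow_iff_of_hasseSchmidt K TA hTA0 hTAK hTAx 𝔭 N h,
    mem_pow_iff_of_hasseSchmidt K TA hTA0 hTAK hTAx 𝔭 (N + 1) h]
  constructor
  · rintro ⟨hlt, hnot⟩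
    refine ⟨hlt, ?_⟩
    by_contra hne
    push Not at hne
    exact hnot fun β hβ => (Nat.lt_succ_iff_lt_or_eq.mp hβ).elim (hlt β) (hne β)
  · rintro ⟨hlt, β, hβN, hβ⟩
    exact ⟨hlt, fun hall => hβ (hall β (by omega))⟩

omit [Fintype σ] [Algebra (MvPolynomial σ K) A] [IsScalarTower K (MvPolynomial σ K) A] in
/-- **The components are global differential operators**: each `D^{[β]} = hsComponent T_A β` is (the underlying map
of) a `K`-linear differential operator of `A` of order `≤ |β|` in Grothendieck's sense (`IsDiffOpLE`; tree
`isDiffOpLE_hsComponentₗ`). [cite: EGAIV4, Thm. 16.11.2 (the `D_q`, `|q| ≤ m`, are differential operators of order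
`≤ m`)] -/
theorem exists_isDiffOpLE_eq_hsComponent (TA : A →+* MvPowerSeries σ A) (hTA0 : ∀ a, constantCoeff (TA a) = a)
    (hTAK : ∀ c : K, TA (algebraMap K A c) = MvPowerSeries.C (algebraMap K A c)) (β : σ →₀ ℕ) :
    ∃ D : A →ₗ[K] A, IsDiffOpLE K (degree β) D ∧ ∀ a, D a = hsComponent TA β a :=
  ⟨hsComponentₗ TA hTAK β, isDiffOpLE_hsComponentₗ TA hTAK hTA0 (degree β) β le_rfl, fun _ => rfl⟩

/-- **Existence package (formally étale chart).** `K` perfect; `A` of finite type over `K`, formally smooth AND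
formally unramified over `K[X_σ]`. There is ONE Hasse–Schmidt homomorphism `T_A : A → A⟦t_σ⟧`
(`constantCoeff ∘ T_A = id`, fixing `K`, `T_A(x_i) = x_i + t_i`) whose components are `K`-linear differential
operators of order `≤ |β|` and CUT OUT THE ORDER STRATA at every maximal ideal: `h ∈ 𝔭^N ⟺ ∀ |β| < N, D^{[β]} h ∈ 𝔭`.
[cite: EGAIV4, Thm. 16.11.2, Prop. 17.1.1 and §17.6] [cite: VillamayorU2008ReesDiff, §4.1 and Remark 4.3]
[cite: Matsumura1987, §27] -/
theorem exists_hasseSchmidt_orderEquations [PerfectField K] [Algebra.FormallySmooth (MvPolynomial σ K) A]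
    [Algebra.FormallyUnramified (MvPolynomial σ K) A] [Algebra.FiniteType K A] :
    ∃ TA : A →+* MvPowerSeries σ A,
      (∀ a, constantCoeff (TA a) = a) ∧
      (∀ c : K, TA (algebraMap K A c) = MvPowerSeries.C (algebraMap K A c)) ∧
      (∀ i, TA (algebraMap (MvPolynomial σ K) A (MvPolynomial.X i)) =
        MvPowerSeries.C (algebraMap (MvPolynomial σ K) A (MvPolynomial.X i)) + MvPowerSeries.X i) ∧
      (∀ β : σ →₀ ℕ, ∃ D : A →ₗ[K] A, IsDiffOpLE K (degree β) D ∧ ∀ a, D a = hsComponent TA β a) ∧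
      ∀ (𝔭 : Ideal A) (_ : 𝔭.IsMaximal) (N : ℕ) (h : A),
        h ∈ 𝔭 ^ N ↔ ∀ β : σ →₀ ℕ, degree β < N → hsComponent TA β h ∈ 𝔭 := by
  obtain ⟨TA, hTA0, hTAR⟩ := exists_hasseSchmidt_of_formallySmooth K A (σ := σ)
  have hTAK := hasseSchmidt_algebraMap_of_taylorShift K TA hTAR
  have hTAx := hasseSchmidt_X_of_taylorShift K TA hTAR
  exact ⟨TA, hTA0, hTAK, hTAx, fun β => exists_isDiffOpLE_eq_hsComponent K TA hTA0 hTAK β,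
    fun 𝔭 _ N h => mem_pow_iff_of_hasseSchmidt K TA hTA0 hTAK hTAx 𝔭 N h⟩

end ChartOrder

end Literature.AlgebraicGeometry.Resolution

end
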